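import Mathlib
import HarnessLib
import Summits.HubbardSuperconductivity.HubbardSuperconductivity.Theorems.KLProgrammeKLRegimeWickCrossContractionGram

/-!
# Route `KLProgramme` — ENGINE child gen 6 (stmt-HubbardSuperconductivity-20236 `KLRegimeEngineV16`), `stub_engine_step_values` (E2-v10):
# the `j`-line DIFFERENCE term of the Wick step as `j` hybrid `k`-line terms, and the bridge's output over the EXPLICIT legs only
# (cell gate-hubbard-kl, seat p5 g5; sequel to `…WickCrossContractionGram`)

`klw_wickPairAmplitude_succ_lines` (p504266) organises the second-order Wick term of the scale step by the number `j` of lines between the two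
copies: the `j`-th term is `(j!)⁻¹·𝒱₄[dblFold((Δ_×(D_n)^j − Δ_×(D_{n+1})^j)(𝒲⁰𝒲¹))]`, `D_n = D_{n+1} + g_{n+1}`.  Here:

* **`crossLaplacian_pow_sub_pow`** — since cross Laplacians commute and are additive in the covariance,
  `Δ_×(D+g)^j − Δ_×(D)^j = Σ_{i<j} (Δ_×(D+g)^i·Δ_×(D)^{j−1−i})·Δ_×(g)`: `j` terms, each with ONE slice line `g` and `j − 1` soft lines
  (`i` of covariance `D+g = D_n`, `j−1−i` of covariance `D = D_{n+1}`);
* **`listProd_cons_append_const`** — each term is a `k`-fold cross contraction in the format of `crossLaplacian_listProd_copy_mul_copy` (p502489):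
  the line family `Fin.cons g (Fin.append (fun _ : Fin p => D) (fun _ : Fin q => E))` on `Fin (p+q+1)` has product `Δ_×(E)^q·Δ_×(D)^p·Δ_×(g)`
  (line `0` = the slice line, as the hybrid bridge wants);
* **`norm_kernel_crossLaplacian_pow_mul_pow_mul_le_gram`** — the hybrid bridge `norm_kernel_crossContract_le_gram` (this seat) for such a term,
  with `e ≥ 1` explicit lines and the other `p + q + 1 − e` lines in the Gram family `{D, E}`;
* `apply_cons_append_const`, `cons_append_const_eq_family` (§4) — the line family under any map (pull-back `SᵀCS`) and as the three-symbol family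
  `![g, D, E] ∘ τ₃` of `…WickCrossContractionGramFamily` (k-uniform Gram base `κ_g² + κ_D² + κ_E²`);
* `prod_ite_lt_eq_prod_castLE`, **`sum_sum_prod_ite_mul_eq_sum_fiber`** — the bridge's double sum re-read over the EXPLICIT legs
  `Xe = X ∘ castLE`, `Ye = Y ∘ castLE` with the Gram legs summed INSIDE the size functions
  `Ka Xe = Σ_{X : X∘castLE = Xe} ‖kernel a (k+m₀) (append X X₀)‖`, `Kb Ye = Σ_{Y : Y∘castLE = Ye} ‖kernel b (k+m₁) (append Y Y₁)‖` — exactly the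
  input `Σ_{Xe,Ye} (∏_{i<e} L_i(Xe i, Ye i))·Ka(Xe)·Kb(Ye)` of p5 g4's sector-level device `Literature.….sum_crossContraction_le` /
  `…_value_le` (p503622 / p511129) with `k + 1 := e` explicit lines; **`norm_kernel_crossContract_le_gram_fiber`** — the bridge in that form.

Generic; no definitions, no named facts, nothing about the model.
-/

noncomputable section

namespace Summit.HubbardSuperconductivity.HubbardSuperconductivity.Theorems.KLRegimeWick

set_option linter.dupNamespace false -- summit = problem name (single-conjunct summit), D-0017

open Literature.MathematicalPhysics.QuantumLattice GrassmannAlgebra Finset Matrix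
open scoped InnerProductSpace

/-! ## §1 Operator algebra: the difference of powers and the line family of one term -/

section Operators

variable (R : Type*) [CommRing R] [Algebra ℚ R] {Γ : Type*} [Fintype Γ]

/-- **The difference of powers of two cross Laplacians whose covariances differ by `g`**:
`Δ_×(D+g)^j − Δ_×(D)^j = Σ_{i<j} (Δ_×(D+g)^i · Δ_×(D)^{j−1−i}) · Δ_×(g)` (commuting, additive in the covariance). [folklore] -/
theorem crossLaplacian_pow_sub_pow (D g : Matrix Γ Γ R) (j : ℕ) :
    grassmannLaplacian R (crossCov R (D + g)) ^ j - grassmannLaplacian R (crossCov R D) ^ j =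
      (∑ i ∈ Finset.range j, grassmannLaplacian R (crossCov R (D + g)) ^ i * grassmannLaplacian R (crossCov R D) ^ (j - 1 - i)) *
        grassmannLaplacian R (crossCov R g) := by
  have h := (commute_grassmannLaplacian R (crossCov R g) (crossCov R D)).geom_sum₂_mul_add j
  rw [← grassmannLaplacian_add, ← crossCov_add, add_comm g D] at h
  rw [← h, add_sub_cancel_right]

omit [Algebra ℚ R] [Fintype Γ] in
/-- Mapping a constant function through `Fin.append`. [folklore] -/
private theorem comp_append_const {α β : Type*} (F : α → β) {p q : ℕ} (D E : α) :
    (fun l => F (Fin.append (fun _ : Fin p => D) (fun _ : Fin q => E) l)) = Fin.append (fun _ : Fin p => F D) (fun _ : Fin q => F E) := by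
  funext l
  refine Fin.addCases (fun i => ?_) (fun i => ?_) l
  · rw [Fin.append_left, Fin.append_left]
  · rw [Fin.append_right, Fin.append_right]

/-- **The line family of one term**: the `k`-fold cross contraction (`k = p + q + 1`, format of `crossLaplacian_listProd_copy_mul_copy`) with the
lines `Fin.cons g (Fin.append (fun _ : Fin p => D) (fun _ : Fin q => E))` is `Δ_×(E)^q · Δ_×(D)^p · Δ_×(g)` — line `0` acts first. [folklore] -/
theorem listProd_cons_append_const (g D E : Matrix Γ Γ R) (p q : ℕ) :
    ((List.ofFn fun l : Fin (p + q + 1) => grassmannLaplacian R (crossCov R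
        ((Fin.cons g (Fin.append (fun _ : Fin p => D) (fun _ : Fin q => E)) : Fin (p + q + 1) → Matrix Γ Γ R) l))).reverse).prod =
      grassmannLaplacian R (crossCov R E) ^ q * grassmannLaplacian R (crossCov R D) ^ p * grassmannLaplacian R (crossCov R g) := by
  rw [List.ofFn_succ]
  simp only [Fin.cons_zero, Fin.cons_succ]
  rw [comp_append_const (fun C : Matrix Γ Γ R => grassmannLaplacian R (crossCov R C)), List.ofFn_fin_append, List.ofFn_const,
    List.ofFn_const, List.reverse_cons, List.reverse_append, List.reverse_replicate, List.reverse_replicate, List.prod_append,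
    List.prod_append, List.prod_replicate, List.prod_replicate, List.prod_singleton]

end Operators

/-! ## §2 The hybrid bridge for one term of the difference -/

section Term

variable {𝕜 : Type*} [RCLike 𝕜] {E : Type*} [NormedAddCommGroup E] [InnerProductSpace 𝕜 E]
variable {Γ : Type*} [Fintype Γ] [DecidableEq Γ] {ι : Type*} [Fintype ι] [DecidableEq ι]

/-- **One term of the difference, without factorial loss**: for `D = Cg s_D`, `E' = Cg s_E` in a charged Gram family (`‖f‖, ‖g‖ ≤ κ`), any slice
covariance `g`, `1 ≤ e ≤ p + q + 1` explicit lines (line `0` = `g`) and the sorting data of the doubled output tuple,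
`‖kernel ((Δ_×(E')^q·Δ_×(D)^p·Δ_×(g))(a⁰·b¹)) m Z̃‖ ≤ ((k+m₀)!(k+m₁)!/(m!·(k−e)!))·(Σ_s κ_s²)^{k−e}·Σ_{X,Y} (∏_{i<e} ‖contr C_i (X i) (Y i)‖)·
‖kernel a (k+m₀) (append X X₀)‖·‖kernel b (k+m₁) (append Y Y₁)‖`, `k = p+q+1`, `C = cons g (append D^p E'^q)`.
[cite: FeldmanKnorrerTrubowitz2004, App. B] -/
theorem norm_kernel_crossLaplacian_pow_mul_pow_mul_le_gram (q : Γ → Bool) (Cg : ι → Matrix Γ Γ 𝕜)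
    (hCg : ∀ s X Y, q X = q Y → Cg s X Y = 0) (f g : ι → Γ → E) (κ : ι → ℝ)
    (hf : ∀ s X, q X = true → ‖f s X‖ ≤ κ s) (hg : ∀ s Y, q Y = false → ‖g s Y‖ ≤ κ s)
    (hG : ∀ s X Y, q X = true → q Y = false → contr 𝕜 (Cg s) X Y = ⟪f s X, g s Y⟫_𝕜)
    (gs D E' : Matrix Γ Γ 𝕜) {sD sE : ι} (hD : D = Cg sD) (hE : E' = Cg sE) {p q' e : ℕ} (he1 : 1 ≤ e) (he : e ≤ p + q' + 1)
    (a b : GrassmannAlgebra 𝕜 Γ) {m : ℕ} (Z : Fin m → Γ × Fin 2)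
    {m₀ m₁ : ℕ} (h : m = m₁ + m₀) (σ : Equiv.Perm (Fin (m₁ + m₀))) (X₀ : Fin m₀ → Γ) (Y₁ : Fin m₁ → Γ)
    (hZ : (Z ∘ Fin.cast h.symm) ∘ σ = Fin.append (fun j => (Y₁ j, (1 : Fin 2))) (fun j => (X₀ j, (0 : Fin 2)))) :
    ‖kernel 𝕜 ((grassmannLaplacian 𝕜 (crossCov 𝕜 E') ^ q' * grassmannLaplacian 𝕜 (crossCov 𝕜 D) ^ p * grassmannLaplacian 𝕜 (crossCov 𝕜 gs))
        (dblCopy 𝕜 0 a * dblCopy 𝕜 1 b)) m Z‖ ≤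
      (((p + q' + 1 + m₀).factorial * (p + q' + 1 + m₁).factorial : ℝ) / (m.factorial * (p + q' + 1 - e).factorial)) *
        (∑ s, κ s ^ 2) ^ (p + q' + 1 - e) *
        ∑ X : Fin (p + q' + 1) → Γ, ∑ Y : Fin (p + q' + 1) → Γ,
          (∏ i : Fin (p + q' + 1), if (i : ℕ) < e then ‖contr 𝕜
            ((Fin.cons gs (Fin.append (fun _ : Fin p => D) (fun _ : Fin q' => E')) : Fin (p + q' + 1) → Matrix Γ Γ 𝕜) i) (X i) (Y i)‖ else 1) *
          (‖kernel 𝕜 a (p + q' + 1 + m₀) (Fin.append X X₀)‖ * ‖kernel 𝕜 b (p + q' + 1 + m₁) (Fin.append Y Y₁)‖) := by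
  rw [← listProd_cons_append_const]
  refine norm_kernel_crossContract_le_gram q Cg hCg f g κ hf hg hG he _
    (fun l : Fin (p + q' + 1) => if (l : ℕ) ≤ p then sD else sE) (fun l hl => ?_) a b Z h σ X₀ Y₁ hZ
  -- the lines `l ≥ e ≥ 1` are `D` (for `l ≤ p`) or `E'`
  obtain ⟨l', rfl⟩ : ∃ l' : Fin (p + q'), l = l'.succ := ⟨l.pred (fun h0 => by simp [h0] at hl; omega), (Fin.succ_pred _ _).symm⟩
  simp only [Fin.cons_succ, Fin.val_succ]
  refine Fin.addCases (fun i => ?_) (fun i => ?_) l'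
  · have hi : (Fin.castAdd q' i : ℕ) + 1 ≤ p := by rw [Fin.val_castAdd]; omega
    simp only [Fin.append_left, hi, if_true, hD]
  · have hi : ¬ ((Fin.natAdd p i : ℕ) + 1 ≤ p) := by rw [Fin.val_natAdd]; omega
    simp only [Fin.append_right, hi, if_false, hE]

end Term

/-! ## §3 The bridge's output over the explicit legs: Gram legs summed inside the size functions -/

section Fiber

variable {Γ : Type*} [Fintype Γ] [DecidableEq Γ]

omit [Fintype Γ] [DecidableEq Γ] in
/-- The explicit-line product over `Fin k` is a product over `Fin e` through `castLE`. [folklore] -/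
theorem prod_ite_lt_eq_prod_castLE {k e : ℕ} (he : e ≤ k) (F : Fin k → ℝ) :
    (∏ i : Fin k, if (i : ℕ) < e then F i else 1) = ∏ i : Fin e, F (Fin.castLE he i) := by
  rw [← prod_filter, ← prod_image (s := (univ : Finset (Fin e))) (fun i _ j _ hij => Fin.castLE_injective he hij)]
  refine prod_congr (Finset.ext fun i => ?_) fun _ _ => rfl
  simp only [mem_filter, mem_univ, true_and, mem_image]
  constructor
  · intro hi
    exact ⟨⟨i, hi⟩, Fin.ext (by simp)⟩
  · rintro ⟨i', rfl⟩
    simp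

/-- **Re-reading the bridge's double sum over the explicit legs**: with `Xe = X ∘ castLE`, `Ye = Y ∘ castLE`,
`Σ_{X,Y} (∏_{i<e} L_i (X i) (Y i))·A(X)·B(Y) = Σ_{Xe,Ye} (∏_{i : Fin e} L_{castLE i} (Xe i) (Ye i))·(Σ_{X∘castLE = Xe} A X)·(Σ_{Y∘castLE = Ye} B Y)`.
[folklore] -/
theorem sum_sum_prod_ite_mul_eq_sum_fiber {k e : ℕ} (he : e ≤ k) (L : Fin k → Γ → Γ → ℝ) (A B : (Fin k → Γ) → ℝ) :
    ∑ X : Fin k → Γ, ∑ Y : Fin k → Γ, (∏ i : Fin k, if (i : ℕ) < e then L i (X i) (Y i) else 1) * (A X * B Y) =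
      ∑ Xe : Fin e → Γ, ∑ Ye : Fin e → Γ, (∏ i : Fin e, L (Fin.castLE he i) (Xe i) (Ye i)) *
        ((∑ X ∈ univ.filter (fun X : Fin k → Γ => (fun i => X (Fin.castLE he i)) = Xe), A X) *
          (∑ Y ∈ univ.filter (fun Y : Fin k → Γ => (fun i => Y (Fin.castLE he i)) = Ye), B Y)) := by
  -- fibre the `X`-sum and the `Y`-sum over the explicit legs
  rw [← sum_fiberwise univ (fun X : Fin k → Γ => fun i => X (Fin.castLE he i))]
  refine sum_congr rfl fun Xe _ => ?_
  rw [sum_comm, ← sum_fiberwise univ (fun Y : Fin k → Γ => fun i => Y (Fin.castLE he i))]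
  refine sum_congr rfl fun Ye _ => ?_
  rw [sum_mul_sum, mul_sum, sum_comm]
  refine sum_congr rfl fun X hX => ?_
  rw [mul_sum]
  refine sum_congr rfl fun Y hY => ?_
  obtain ⟨-, hXe⟩ := mem_filter.1 hX
  obtain ⟨-, hYe⟩ := mem_filter.1 hY
  rw [prod_ite_lt_eq_prod_castLE he]
  subst hXe hYe
  ring

variable {𝕜 : Type*} [RCLike 𝕜] {E : Type*} [NormedAddCommGroup E] [InnerProductSpace 𝕜 E]
variable {ι : Type*} [Fintype ι] [DecidableEq ι]

/-- **The hybrid bridge over the explicit legs** (`norm_kernel_crossContract_le_gram` + `sum_sum_prod_ite_mul_eq_sum_fiber`): the size functions of p5 g4's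
sector-level device with `e` explicit lines are `Ka Xe = Σ_{X∘castLE = Xe} ‖kernel a (k+m₀) (append X X₀)‖` (the Gram legs of `a` summed with its
explicit legs fixed) and `Kb Ye` likewise. [cite: FeldmanKnorrerTrubowitz2004, App. B] -/
theorem norm_kernel_crossContract_le_gram_fiber (q : Γ → Bool) (Cg : ι → Matrix Γ Γ 𝕜) (hCg : ∀ s X Y, q X = q Y → Cg s X Y = 0)
    (f g : ι → Γ → E) (κ : ι → ℝ) (hf : ∀ s X, q X = true → ‖f s X‖ ≤ κ s) (hg : ∀ s Y, q Y = false → ‖g s Y‖ ≤ κ s)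
    (hG : ∀ s X Y, q X = true → q Y = false → contr 𝕜 (Cg s) X Y = ⟪f s X, g s Y⟫_𝕜)
    {k e : ℕ} (he : e ≤ k) (C : Fin k → Matrix Γ Γ 𝕜) (τ : Fin k → ι) (hCτ : ∀ i : Fin k, e ≤ (i : ℕ) → C i = Cg (τ i))
    (a b : GrassmannAlgebra 𝕜 Γ) {m : ℕ} (Z : Fin m → Γ × Fin 2)
    {m₀ m₁ : ℕ} (h : m = m₁ + m₀) (σ : Equiv.Perm (Fin (m₁ + m₀))) (X₀ : Fin m₀ → Γ) (Y₁ : Fin m₁ → Γ)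
    (hZ : (Z ∘ Fin.cast h.symm) ∘ σ = Fin.append (fun j => (Y₁ j, (1 : Fin 2))) (fun j => (X₀ j, (0 : Fin 2)))) :
    ‖kernel 𝕜 (((List.ofFn fun i => grassmannLaplacian 𝕜 (crossCov 𝕜 (C i))).reverse).prod (dblCopy 𝕜 0 a * dblCopy 𝕜 1 b)) m Z‖ ≤
      (((k + m₀).factorial * (k + m₁).factorial : ℝ) / (m.factorial * (k - e).factorial)) * (∑ s, κ s ^ 2) ^ (k - e) *
        ∑ Xe : Fin e → Γ, ∑ Ye : Fin e → Γ, (∏ i : Fin e, ‖contr 𝕜 (C (Fin.castLE he i)) (Xe i) (Ye i)‖) *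
          ((∑ X ∈ univ.filter (fun X : Fin k → Γ => (fun i => X (Fin.castLE he i)) = Xe), ‖kernel 𝕜 a (k + m₀) (Fin.append X X₀)‖) *
            (∑ Y ∈ univ.filter (fun Y : Fin k → Γ => (fun i => Y (Fin.castLE he i)) = Ye), ‖kernel 𝕜 b (k + m₁) (Fin.append Y Y₁)‖)) := by
  rw [← sum_sum_prod_ite_mul_eq_sum_fiber he (fun i X Y => ‖contr 𝕜 (C i) X Y‖)]
  exact norm_kernel_crossContract_le_gram q Cg hCg f g κ hf hg hG he C τ hCτ a b Z h σ X₀ Y₁ hZ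

end Fiber

/-! ## §4 The line family of one term in the FAMILY keying (three symbols) and under a pull-back -/

section FamilyKeying

variable {α β : Type*}

/-- **Any map commutes with the line family of one term**: `φ ∘ cons g (append D^p E^q) = cons (φ g) (append (φ D)^p (φ E)^q)` — e.g.
`φ C = S(F)ᵀ·C·S(F)` (the pulled-back lines of `dblFold_crossContract_map`) or `φ C = Δ_×(C)`. [folklore] -/
theorem apply_cons_append_const (φ : α → β) {p q : ℕ} (g D E : α) :
    (fun l => φ ((Fin.cons g (Fin.append (fun _ : Fin p => D) (fun _ : Fin q => E)) : Fin (p + q + 1) → α) l)) =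
      (Fin.cons (φ g) (Fin.append (fun _ : Fin p => φ D) (fun _ : Fin q => φ E)) : Fin (p + q + 1) → β) := by
  funext l
  refine Fin.cases ?_ (fun l' => ?_) l
  · simp only [Fin.cons_zero]
  · simp only [Fin.cons_succ]
    refine Fin.addCases (fun i => ?_) (fun i => ?_) l'
    · rw [Fin.append_left, Fin.append_left]
    · rw [Fin.append_right, Fin.append_right]

/-- **The line family of one term is a three-symbol family**: with `sym₃ = ![g, D, E]` and the assignment
`τ₃ l = 0` (l = 0), `1` (1 ≤ l ≤ p), `2` (l > p): `cons g (append D^p E^q) = sym₃ ∘ τ₃` — the keying of `…WickCrossContractionGramFamily`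
(Gram base `κ_g² + κ_D² + κ_E²`, independent of the line number). [folklore] -/
theorem cons_append_const_eq_family {p q : ℕ} (g D E : α) :
    (Fin.cons g (Fin.append (fun _ : Fin p => D) (fun _ : Fin q => E)) : Fin (p + q + 1) → α) =
      fun l : Fin (p + q + 1) => (![g, D, E] : Fin 3 → α)
        (if (l : ℕ) = 0 then (0 : Fin 3) else if (l : ℕ) ≤ p then (1 : Fin 3) else (2 : Fin 3)) := by
  funext l
  refine Fin.cases ?_ (fun l' => ?_) l
  · simp only [Fin.cons_zero, Fin.val_zero, if_true, Matrix.cons_val_zero]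
  · simp only [Fin.cons_succ, Fin.val_succ, Nat.succ_ne_zero, if_false]
    refine Fin.addCases (fun i => ?_) (fun i => ?_) l'
    · have hi : (Fin.castAdd q i : ℕ) + 1 ≤ p := by rw [Fin.val_castAdd]; omega
      rw [Fin.append_left, if_pos hi]
      rfl
    · have hi : ¬ ((Fin.natAdd p i : ℕ) + 1 ≤ p) := by rw [Fin.val_natAdd]; omega
      rw [Fin.append_right, if_neg hi]
      rfl

end FamilyKeying

end Summit.HubbardSuperconductivity.HubbardSuperconductivity.Theorems.KLRegimeWick

end
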